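import Mathlib
import Summits.NavierStokesRegularity.NavierStokesRegularity.Theorems.LerayQuarterDissipationFiniteDissipationLiouvillePersistenceSeq
import Literature.Analysis.FluidPDE.HolderExtraction
import Literature.Analysis.FluidPDE.SpaceTimeCalculus
import HarnessLib

/-!
# Crux `FiniteDissipationLiouville` (stmt-NavierStokesRegularity-22144): KNSS COMPACTNESS ACROSS MEMBERS
# WITH UNIFORM CONVERGENCE OF THE 2-JET (tool)

Theorems file of route `LerayQuarterDissipation` (lead prover g19; `--supports` the crux; sequel of
ns-lqd-p1's `…PersistenceSeq`). Navier–Stokes regularity is NOT proved by anything here; no summit is.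

`…Compactness.seqLimit` exports, along a subsequence, UNIFORM convergence of the VALUES on the slab
pieces `[−(n+2), −1/(n+2)] × B̄(0, n+2)` and POINTWISE convergence of values and gradients. The tree's
extraction behind it (`exists_tendstoUniformlyOn_triple_of_typeI_oseenMild_windows`) is in fact
`C²_loc`: values, gradients AND Hessians converge uniformly on the slab pieces, to some limits
`(W₁, G, H)`. This file identifies those limits with the jet of the class limit `W`:

* **`seqLimit₂`** — every sequence `w k` of KNSS-gauge Type-I fields with a common constant `C` has a
  subsequence `w (ψ j)` and a limit `W` of the same class with: values → `W`, gradients → `∇W` and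
  Hessians → `∇²W` UNIFORMLY ON EVERY SLAB PIECE, plus the pointwise statements of `seqLimit`.
  (Identification: pointwise limits are unique for the gradients; for the Hessians, the slice-wise
  locally uniform convergence of `∇²(w_j t)` (Literature `tendstoLocallyUniformly_slice_of_tendstoUniformlyOn_slabPiece`)
  and the pointwise convergence of `∇(w_j t)` give `HasFDerivAt (∇(W t)) (H t x) x`, Mathlib
  `hasFDerivAt_of_tendstoLocallyUniformlyOn`.)
* `tendstoUniformlyOn_curl_of_seqLimit₂`, `tendstoUniformlyOn_fderiv_curl_of_seqLimit₂` — the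
  vorticity and its gradient converge uniformly on the slab pieces (continuous linear images).

Use: closedness of ANY hypothesis that is a continuous function of the 2-jet `(u, ∇u, ∇²u)` becomes
immediate, and the «blob» form of the window socket (interior of the violation set, `…WindowFastBlob`)
extends from the velocity to every 2-jet read-out (sequel).

HONEST FRAMING. A repackaging of tree extraction theorems (nsreg `…WindowExtractionTriple`,
Literature `HolderExtraction`); no new analysis. Nothing here bears on NS regularity or on the DSS wall.

References: Koch–Nadirashvili–Seregin–Šverák, Acta Math. 203 (2009) §4 (arXiv:0709.3599 p. 8).
-/

noncomputable section

set_option linter.dupNamespace false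

namespace Summit.NavierStokesRegularity.NavierStokesRegularity.Theorems.FiniteDissipationLiouville.Compactness

open MeasureTheory Set Filter Topology Metric Function
open Literature.Analysis Literature.Analysis.FluidPDE Literature.Analysis.UnboundedOperators
open Summit.NavierStokesRegularity.NavierStokesRegularity.Theorems.AdaptedFrequencyConverges.BirkhoffRecurrentHull
  (tendstoUniformlyOn_comp_of_tendsto)
open scoped ENNReal NNReal

/-- **KNSS compactness across members, `C²_loc` form with identified limits.** See the module docstring.
[cite: KochNadirashviliSereginSverak2009, Prop. 4.1 (arXiv:0709.3599 p. 8)] -/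
theorem seqLimit₂ {C : ℝ} {w : ℕ → ℝ → EuclideanSpace ℝ (Fin 3) → EuclideanSpace ℝ (Fin 3)}
    (hwk : ∀ k, IsTypeIAncientMild C (w k)) :
    ∃ ψ : ℕ → ℕ, StrictMono ψ ∧
      ∃ W : ℝ → EuclideanSpace ℝ (Fin 3) → EuclideanSpace ℝ (Fin 3),
        IsTypeIAncientMild C W ∧
        (∀ n : ℕ, TendstoUniformlyOn (fun j z => w (ψ j) z.1 z.2) (fun z => W z.1 z.2)
          atTop (Icc (-((n : ℝ) + 2)) (-(1 / ((n : ℝ) + 2))) ×ˢ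
            closedBall (0 : EuclideanSpace ℝ (Fin 3)) ((n : ℝ) + 2))) ∧
        (∀ t < 0, ∀ x, Tendsto (fun j => w (ψ j) t x) atTop (𝓝 (W t x))) ∧
        (∀ t < 0, ∀ x, Tendsto (fun j => fderiv ℝ (w (ψ j) t) x) atTop (𝓝 (fderiv ℝ (W t) x))) ∧
        (∀ n : ℕ, TendstoUniformlyOn (fun j z => fderiv ℝ (w (ψ j) z.1) z.2) (fun z => fderiv ℝ (W z.1) z.2)
          atTop (Icc (-((n : ℝ) + 2)) (-(1 / ((n : ℝ) + 2))) ×ˢ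
            closedBall (0 : EuclideanSpace ℝ (Fin 3)) ((n : ℝ) + 2))) ∧
        (∀ n : ℕ, TendstoUniformlyOn (fun j z => fderiv ℝ (fderiv ℝ (w (ψ j) z.1)) z.2)
          (fun z => fderiv ℝ (fderiv ℝ (W z.1)) z.2)
          atTop (Icc (-((n : ℝ) + 2)) (-(1 / ((n : ℝ) + 2))) ×ˢ
            closedBall (0 : EuclideanSpace ℝ (Fin 3)) ((n : ℝ) + 2))) := by
  -- adapted from `…Compactness.seqLimit` (ns-lqd-p1): the same two extractions, keeping `G` and `H`
  have hC : 0 ≤ C := (hwk 0).nonneg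
  set A : ℕ → ℝ := fun k => -((k : ℝ) + 1) with hA
  have hAt : Tendsto A atTop atBot :=
    tendsto_neg_atTop_atBot.comp (tendsto_atTop_add_const_right _ 1 tendsto_natCast_atTop_atTop)
  have hcw : ∀ k, ContinuousOn (uncurry (w k)) (Ioo (A k) 0 ×ˢ univ) := fun k =>
    (hwk k).continuousOn_uncurry.mono (prod_mono Ioo_subset_Iio_self Subset.rfl)
  have hdivw : ∀ k, ∀ t ∈ Ioo (A k) 0, IsWeaklyDivFree (w k t) := fun k t ht =>
    (hwk k).isWeaklyDivFree ht.2
  have hmild : ∀ k, ∀ s t : ℝ, A k < s → s < t → t < 0 → ∀ x,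
      w k t x = Literature.Analysis.UnboundedOperators.heatExtension (w k s) (t - s) x -
        oseenDuhamel 1 s (w k) (w k) t x :=
    fun k s t _ hst ht x => (hwk k).mild_eq_heatExtension hst ht x
  have hIw : ∀ k, ∀ t ∈ Ioo (A k) 0, ∀ x, ‖w k t x‖ ≤ C / Real.sqrt (-t) := fun k t ht x =>
    (hwk k).norm_le ht.2 x
  -- ## Step 1: `C²_loc` extraction
  obtain ⟨φ₁, hφ₁, W₁, G, H, hW₁, hG, hH⟩ :=
    exists_tendstoUniformlyOn_triple_of_typeI_oseenMild_windows hC hAt hcw hdivw hmild hIw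
  have hφ₁t : Tendsto φ₁ atTop atTop := hφ₁.tendsto_atTop
  -- ## Step 2: the class limit along a further subsequence (`seqLimit` on the subsequence)
  obtain ⟨φ₂, hφ₂, W, hW, hunif, hpt, hgr⟩ := seqLimit (w := fun j => w (φ₁ j)) (fun j => hwk (φ₁ j))
  have hφ₂t : Tendsto φ₂ atTop atTop := hφ₂.tendsto_atTop
  -- gradients: uniform to `G` along `φ₁ ∘ φ₂`, pointwise to `∇W`; hence `G = ∇W` on the open slab
  have hGu : ∀ n : ℕ, TendstoUniformlyOn (fun j z => fderiv ℝ (w (φ₁ (φ₂ j)) z.1) z.2) (fun z => G z.1 z.2)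
      atTop (Icc (-((n : ℝ) + 2)) (-(1 / ((n : ℝ) + 2))) ×ˢ
        closedBall (0 : EuclideanSpace ℝ (Fin 3)) ((n : ℝ) + 2)) := fun n =>
    tendstoUniformlyOn_comp_of_tendsto (hG n) hφ₂t
  have hGW : ∀ t < 0, ∀ x, G t x = fderiv ℝ (W t) x := by
    intro t ht x
    have h1 : Tendsto (fun j => fderiv ℝ (w (φ₁ (φ₂ j)) t) x) atTop (𝓝 (G t x)) :=
      tendsto_of_tendstoUniformlyOn_slabPiece (V := fun j (z : ℝ × EuclideanSpace ℝ (Fin 3)) =>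
        fderiv ℝ (w (φ₁ (φ₂ j)) z.1) z.2) (W := fun z => G z.1 z.2) hGu ht x
    exact tendsto_nhds_unique h1 (hgr t ht x)
  have hGu' : ∀ n : ℕ, TendstoUniformlyOn (fun j z => fderiv ℝ (w (φ₁ (φ₂ j)) z.1) z.2)
      (fun z => fderiv ℝ (W z.1) z.2) atTop
      (Icc (-((n : ℝ) + 2)) (-(1 / ((n : ℝ) + 2))) ×ˢ closedBall (0 : EuclideanSpace ℝ (Fin 3)) ((n : ℝ) + 2)) :=
    fun n => (hGu n).congr_right fun z hz => hGW z.1 (neg_of_mem_slabPiece hz) z.2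
  -- Hessians: uniform to `H` along `φ₁ ∘ φ₂`; identify `H = ∇²W` by the uniform-limit derivative theorem
  have hHu : ∀ n : ℕ, TendstoUniformlyOn (fun j z => fderiv ℝ (fderiv ℝ (w (φ₁ (φ₂ j)) z.1)) z.2)
      (fun z => H z.1 z.2) atTop
      (Icc (-((n : ℝ) + 2)) (-(1 / ((n : ℝ) + 2))) ×ˢ closedBall (0 : EuclideanSpace ℝ (Fin 3)) ((n : ℝ) + 2)) :=
    fun n => by
      have h := tendstoUniformlyOn_comp_of_tendsto (β := EuclideanSpace ℝ (Fin 3) →L[ℝ] EuclideanSpace ℝ (Fin 3) →L[ℝ] EuclideanSpace ℝ (Fin 3)) (hH n) hφ₂t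
      exact h
  have hHW : ∀ t < 0, ∀ x, H t x = fderiv ℝ (fderiv ℝ (W t)) x := by
    intro t ht x
    -- slice-wise locally uniform convergence of the Hessians
    have hloc := tendstoLocallyUniformly_slice_of_tendstoUniformlyOn_slabPiece
      (V := fun j (z : ℝ × EuclideanSpace ℝ (Fin 3)) => fderiv ℝ (fderiv ℝ (w (φ₁ (φ₂ j)) z.1)) z.2)
      (W := fun z => H z.1 z.2) hHu ht
    -- each `∇(w_j t)` is differentiable with derivative `∇²(w_j t)`
    have hdiff : ∀ j, ∀ y ∈ (univ : Set (EuclideanSpace ℝ (Fin 3))),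
        HasFDerivAt (fderiv ℝ (w (φ₁ (φ₂ j)) t)) (fderiv ℝ (fderiv ℝ (w (φ₁ (φ₂ j)) t)) y) y := by
      intro j y _
      have hsm : IsSmoothSpaceTimeOn (Iio 0) (w (φ₁ (φ₂ j))) := (hwk _).contDiffOn
      have hsl : ContDiff ℝ ((⊤ : ℕ∞) : WithTop ℕ∞) (w (φ₁ (φ₂ j)) t) := hsm.contDiff_slice ht
      have h1 : ContDiff ℝ 1 (fderiv ℝ (w (φ₁ (φ₂ j)) t)) := hsl.fderiv_right (m := 1) (by norm_cast)
      exact (h1.differentiable one_ne_zero y).hasFDerivAt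
    have hkey := hasFDerivAt_of_tendstoLocallyUniformlyOn isOpen_univ
      (tendstoLocallyUniformlyOn_univ.2 hloc) hdiff (fun y _ => hgr t ht y) (mem_univ x)
    exact hkey.fderiv.symm
  have hHu' : ∀ n : ℕ, TendstoUniformlyOn (fun j z => fderiv ℝ (fderiv ℝ (w (φ₁ (φ₂ j)) z.1)) z.2)
      (fun z => fderiv ℝ (fderiv ℝ (W z.1)) z.2) atTop
      (Icc (-((n : ℝ) + 2)) (-(1 / ((n : ℝ) + 2))) ×ˢ closedBall (0 : EuclideanSpace ℝ (Fin 3)) ((n : ℝ) + 2)) :=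
    fun n => (hHu n).congr_right fun z hz => hHW z.1 (neg_of_mem_slabPiece hz) z.2
  exact ⟨fun j => φ₁ (φ₂ j), hφ₁.comp hφ₂, W, hW, hunif, hpt, hgr, hGu', hHu'⟩

/-- Uniform convergence of the vorticities on the slab pieces along `seqLimit₂`-type data. [folklore] -/
theorem tendstoUniformlyOn_curl_of_fderiv {v : ℕ → ℝ → EuclideanSpace ℝ (Fin 3) → EuclideanSpace ℝ (Fin 3)}
    {W : ℝ → EuclideanSpace ℝ (Fin 3) → EuclideanSpace ℝ (Fin 3)} {S : Set (ℝ × EuclideanSpace ℝ (Fin 3))}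
    (h : TendstoUniformlyOn (fun j z => fderiv ℝ (v j z.1) z.2) (fun z => fderiv ℝ (W z.1) z.2) atTop S) :
    TendstoUniformlyOn (fun j z => curl (v j z.1) z.2) (fun z => curl (W z.1) z.2) atTop S := by
  have hc : UniformContinuous (curlCLM : (EuclideanSpace ℝ (Fin 3) →L[ℝ] EuclideanSpace ℝ (Fin 3)) →
      EuclideanSpace ℝ (Fin 3)) := curlCLM.uniformContinuous
  have h2 := hc.comp_tendstoUniformlyOn h
  refine h2.congr (Eventually.of_forall fun j => ?_) |>.congr_right ?_
  · intro z _; simp [Function.comp, curl_eq_curlCLM]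
  · intro z _; simp [Function.comp, curl_eq_curlCLM]

/-- Uniform convergence of the vorticity GRADIENTS on the slab pieces from that of the Hessians:
`∇(curl u) = curlCLM ∘ ∇²u` pointwise. [folklore] -/
theorem fderiv_curl_eq_comp {u : EuclideanSpace ℝ (Fin 3) → EuclideanSpace ℝ (Fin 3)}
    (hu : ContDiff ℝ 2 u) (x : EuclideanSpace ℝ (Fin 3)) :
    fderiv ℝ (curl u) x = (curlCLM : (EuclideanSpace ℝ (Fin 3) →L[ℝ] EuclideanSpace ℝ (Fin 3)) →L[ℝ]
      EuclideanSpace ℝ (Fin 3)).comp (fderiv ℝ (fderiv ℝ u) x) := by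
  have e : curl u = fun y => curlCLM (fderiv ℝ u y) := funext fun y => curl_eq_curlCLM u y
  rw [e]
  have hd : DifferentiableAt ℝ (fderiv ℝ u) x :=
    ((hu.fderiv_right (m := 1) (by norm_num)).differentiable one_ne_zero) x
  exact (curlCLM.hasFDerivAt.comp x hd.hasFDerivAt).fderiv

/-- Uniform convergence of `∇ curl` on a set from that of the Hessians (members of the class).
[folklore] -/
theorem tendstoUniformlyOn_fderiv_curl_of_hessian {C : ℝ}
    {v : ℕ → ℝ → EuclideanSpace ℝ (Fin 3) → EuclideanSpace ℝ (Fin 3)}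
    {W : ℝ → EuclideanSpace ℝ (Fin 3) → EuclideanSpace ℝ (Fin 3)}
    (hv : ∀ j, IsTypeIAncientMild C (v j)) (hW : IsTypeIAncientMild C W)
    {S : Set (ℝ × EuclideanSpace ℝ (Fin 3))} (hS : ∀ z ∈ S, z.1 < 0)
    (h : TendstoUniformlyOn (fun j z => fderiv ℝ (fderiv ℝ (v j z.1)) z.2)
      (fun z => fderiv ℝ (fderiv ℝ (W z.1)) z.2) atTop S) :
    TendstoUniformlyOn (fun j z => fderiv ℝ (curl (v j z.1)) z.2) (fun z => fderiv ℝ (curl (W z.1)) z.2)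
      atTop S := by
  have hslice : ∀ {u : ℝ → EuclideanSpace ℝ (Fin 3) → EuclideanSpace ℝ (Fin 3)}, IsTypeIAncientMild C u →
      ∀ z ∈ S, fderiv ℝ (curl (u z.1)) z.2 =
        (curlCLM : (EuclideanSpace ℝ (Fin 3) →L[ℝ] EuclideanSpace ℝ (Fin 3)) →L[ℝ]
          EuclideanSpace ℝ (Fin 3)).comp (fderiv ℝ (fderiv ℝ (u z.1)) z.2) := by
    intro u hu z hz
    have hsm : IsSmoothSpaceTimeOn (Iio 0) u := hu.contDiffOn
    have hsl : ContDiff ℝ 2 (u z.1) := (hsm.contDiff_slice (hS z hz)).of_le (by norm_cast)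
    exact fderiv_curl_eq_comp hsl z.2
  -- re-type `h` with the metric uniformity of the operator norm (definitionally the same instance)
  have hm : @TendstoUniformlyOn (ℝ × EuclideanSpace ℝ (Fin 3)) (EuclideanSpace ℝ (Fin 3) →L[ℝ] EuclideanSpace ℝ (Fin 3) →L[ℝ] EuclideanSpace ℝ (Fin 3)) ℕ
      PseudoMetricSpace.toUniformSpace (fun j z => fderiv ℝ (fderiv ℝ (v j z.1)) z.2)
      (fun z => fderiv ℝ (fderiv ℝ (W z.1)) z.2) atTop S := h
  have h' := (Metric.tendstoUniformlyOn_iff (α := EuclideanSpace ℝ (Fin 3) →L[ℝ] EuclideanSpace ℝ (Fin 3) →L[ℝ] EuclideanSpace ℝ (Fin 3))).1 hm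
  refine (Metric.tendstoUniformlyOn_iff (α := EuclideanSpace ℝ (Fin 3) →L[ℝ] EuclideanSpace ℝ (Fin 3))).2 fun ε hε => ?_
  set K : ℝ := ‖(curlCLM : (EuclideanSpace ℝ (Fin 3) →L[ℝ] EuclideanSpace ℝ (Fin 3)) →L[ℝ]
    EuclideanSpace ℝ (Fin 3))‖ + 1 with hK
  have hKpos : 0 < K := by rw [hK]; positivity
  filter_upwards [h' (ε / K) (by positivity)] with j hj z hz
  have hd := hj z hz
  have hd' : ‖fderiv ℝ (fderiv ℝ (W z.1)) z.2 - fderiv ℝ (fderiv ℝ (v j z.1)) z.2‖ < ε / K :=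
    calc ‖fderiv ℝ (fderiv ℝ (W z.1)) z.2 - fderiv ℝ (fderiv ℝ (v j z.1)) z.2‖
        = dist (fderiv ℝ (fderiv ℝ (W z.1)) z.2) (fderiv ℝ (fderiv ℝ (v j z.1)) z.2) :=
          (dist_eq_norm (fderiv ℝ (fderiv ℝ (W z.1)) z.2) (fderiv ℝ (fderiv ℝ (v j z.1)) z.2)).symm
      _ < ε / K := hd
  rw [hslice hW z hz, hslice (hv j) z hz, dist_eq_norm, ← ContinuousLinearMap.comp_sub]
  calc ‖(curlCLM : (EuclideanSpace ℝ (Fin 3) →L[ℝ] EuclideanSpace ℝ (Fin 3)) →L[ℝ]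
          EuclideanSpace ℝ (Fin 3)).comp
          (fderiv ℝ (fderiv ℝ (W z.1)) z.2 - fderiv ℝ (fderiv ℝ (v j z.1)) z.2)‖
      ≤ ‖(curlCLM : (EuclideanSpace ℝ (Fin 3) →L[ℝ] EuclideanSpace ℝ (Fin 3)) →L[ℝ]
          EuclideanSpace ℝ (Fin 3))‖ *
          ‖fderiv ℝ (fderiv ℝ (W z.1)) z.2 - fderiv ℝ (fderiv ℝ (v j z.1)) z.2‖ :=
        ContinuousLinearMap.opNorm_comp_le _ _
    _ ≤ K * ‖fderiv ℝ (fderiv ℝ (W z.1)) z.2 - fderiv ℝ (fderiv ℝ (v j z.1)) z.2‖ :=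
        mul_le_mul_of_nonneg_right (by rw [hK]; linarith)
          (norm_nonneg (fderiv ℝ (fderiv ℝ (W z.1)) z.2 - fderiv ℝ (fderiv ℝ (v j z.1)) z.2))
    _ < K * (ε / K) := mul_lt_mul_of_pos_left hd' hKpos
    _ = ε := by field_simp

end Summit.NavierStokesRegularity.NavierStokesRegularity.Theorems.FiniteDissipationLiouville.Compactness

end
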